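import Literature.Geometry.Riemannian.PinchingEstimatesSingularMax
import Literature.Geometry.Riemannian.PinchingEstimatesTwoLargestCore
import HarnessLib

/-!
# Spectral handles for Hamilton's improving pinching estimate (Thm. 2.1): pointwise algebra
(topic `Geometry/Riemannian`)

Part of the decomposition of `Literature.Geometry.Riemannian.hamilton_chenZhu_pinching`
(`PinchingEstimates.lean`), towards the ODE part of Hamilton 1997, Thm. 2.1 with Lemma 2.2
(pp. 13–16). Hamilton's differential inequalities (p. 15)
`d/dt ln(a₁ + a₂) ≥ 2a₃ + 2b₁ + [(a₁ - b₁)² + (a₂ - b₂)² + 2a₂(b₂ - b₁)]/(a₁ + a₂)`,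
`d/dt ln b₃ ≤ a₃ + c₃ + 2b₁b₂/b₃` are written in terms of the individual eigenvalues `a₁ ≤ a₂ ≤ a₃`
of `A` and singular values `b₁ ≤ b₂ ≤ b₃` of `B`. In the tree's variational language (extrema of
quadratic forms over unit vectors and orthonormal pairs) we PROVE here the two packages of
pointwise identities and inequalities that replace them, for arbitrary `3 × 3` matrices:

* `planeMin_package` — for symmetric `A` and an orthonormal pair `(w, w')` minimising the pair
  sum `wᵀAw + w'ᵀAw'` (`= a₁ + a₂`): there are `a₁ ≤ a₂ ≤ a₃` with `a₁ + a₂` the pair sum, `a₁` and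
  `a₃` the extreme Rayleigh quotients (`a₃ = nᵀAn` at the unit normal `n`), and the EXACT identity
  `wᵀA'w + w'ᵀA'w' = a₁² + a₂² + (tr(BᵀB) - |ᵗBn|²) + 2a₃(a₁ + a₂)` for `A' = A² + BᵗB + 2A^#`
  (the minimising plane contains a global Rayleigh minimiser — exchange argument — and is spanned
  by eigenvectors);
* `singularMax_package` — at a maximising pair `(u, v)` of `uᵀBv` with value `Y > 0` (`= b₃`):
  `uᵀB'v = Y(uᵀAu + vᵀCv) + 2 det B / Y` for `B' = AB + BC + 2B^#`, and with
  `β = min |ᵗBg|` (`= b₁`) and `F = tr(BᵗB)` (`= b₁² + b₂² + b₃²`): `Y² + 2β² ≤ F ≤ 2Y² + β²` and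
  `|det B| ≤ β(F - β²)/2` (so that `2|det B|/Y² ≤ β(1 + b₂²/Y²) ≤ 2β`, Hamilton's `2b₁b₂/b₃ ≤ 2b₁`).

## References

* R. S. Hamilton, Comm. Anal. Geom. 5 (1997), §2.2, Thm. 2.1 and Lemma 2.2 (pp. 13–16). [Hamilton1997]
* R. S. Hamilton, J. Differential Geom. 24 (1986), §6, Lemma 6.1 (p. 167). [Hamilton1986]
-/

noncomputable section

open Set Real
open scoped Matrix BigOperators

namespace Literature.Geometry.Riemannian

namespace HamiltonODE

variable {A B C : Matrix (Fin 3) (Fin 3) ℝ}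

/-! ### Sums of `|ᵗBg|²` over orthonormal bases -/

/-- `|ᵗBe₁|² + |ᵗBe₂|² + |ᵗBe₃|² = tr(B ᵗB)` for an orthonormal basis. [folklore] -/
theorem sum_normSq_transpose_eq_trace {e₁ e₂ e₃ : Fin 3 → ℝ} (h₁ : e₁ ⬝ᵥ e₁ = 1)
    (h₂ : e₂ ⬝ᵥ e₂ = 1) (h₃ : e₃ ⬝ᵥ e₃ = 1) (h₁₂ : e₁ ⬝ᵥ e₂ = 0) (h₁₃ : e₁ ⬝ᵥ e₃ = 0)
    (h₂₃ : e₂ ⬝ᵥ e₃ = 0) :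
    (Bᵀ *ᵥ e₁) ⬝ᵥ (Bᵀ *ᵥ e₁) + (Bᵀ *ᵥ e₂) ⬝ᵥ (Bᵀ *ᵥ e₂) + (Bᵀ *ᵥ e₃) ⬝ᵥ (Bᵀ *ᵥ e₃) =
      (B * Bᵀ).trace := by
  rw [← quad_mul_transpose_self, ← quad_mul_transpose_self, ← quad_mul_transpose_self]
  exact sum_quadratic_eq_trace_of_orthonormal (B * Bᵀ) h₁ h₂ h₃ h₁₂ h₁₃ h₂₃

/-- `|Be₁|² + |Be₂|² + |Be₃|² = tr(B ᵗB)` for an orthonormal basis (`tr(ᵗB B) = tr(B ᵗB)`). [folklore] -/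
theorem sum_normSq_eq_trace {e₁ e₂ e₃ : Fin 3 → ℝ} (h₁ : e₁ ⬝ᵥ e₁ = 1)
    (h₂ : e₂ ⬝ᵥ e₂ = 1) (h₃ : e₃ ⬝ᵥ e₃ = 1) (h₁₂ : e₁ ⬝ᵥ e₂ = 0) (h₁₃ : e₁ ⬝ᵥ e₃ = 0)
    (h₂₃ : e₂ ⬝ᵥ e₃ = 0) :
    (B *ᵥ e₁) ⬝ᵥ (B *ᵥ e₁) + (B *ᵥ e₂) ⬝ᵥ (B *ᵥ e₂) + (B *ᵥ e₃) ⬝ᵥ (B *ᵥ e₃) =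
      (B * Bᵀ).trace := by
  have h := sum_normSq_transpose_eq_trace (B := Bᵀ) h₁ h₂ h₃ h₁₂ h₁₃ h₂₃
  rw [Matrix.transpose_transpose] at h
  rw [h, Matrix.trace_mul_comm]

/-! ### The minimising plane of the pair sum: an in-plane eigenbasis -/

/-- A minimiser of a continuous function on the unit vectors orthogonal to a unit `n` exists.
[folklore] -/
theorem exists_min_rayleigh_perp (M : Matrix (Fin 3) (Fin 3) ℝ) {n w : Fin 3 → ℝ}
    (hw : w ⬝ᵥ w = 1) (hwn : w ⬝ᵥ n = 0) :
    ∃ e : Fin 3 → ℝ, e ⬝ᵥ e = 1 ∧ e ⬝ᵥ n = 0 ∧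
      ∀ g : Fin 3 → ℝ, g ⬝ᵥ g = 1 → g ⬝ᵥ n = 0 → e ⬝ᵥ (M *ᵥ e) ≤ g ⬝ᵥ (M *ᵥ g) := by
  set S : Set (Fin 3 → ℝ) := unitSet ∩ {g | g ⬝ᵥ n = 0} with hS
  have hSc : IsCompact S :=
    isCompact_unitSet.inter_right (isClosed_eq (continuous_id.dotProduct continuous_const) continuous_const)
  have hSne : S.Nonempty := ⟨w, hw, hwn⟩
  have hc : Continuous fun g : Fin 3 → ℝ ↦ g ⬝ᵥ (M *ᵥ g) :=
    continuous_id.dotProduct (continuous_const.matrix_mulVec continuous_id)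
  obtain ⟨e, ⟨he, hen⟩, hmin⟩ := hSc.exists_isMinOn hSne hc.continuousOn
  refine ⟨e, he, hen, fun g hg hgn ↦ ?_⟩
  have h := hmin (show g ∈ S from ⟨hg, hgn⟩)
  simp only [mem_setOf_eq] at h
  exact h

/-- A global minimiser of the Rayleigh quotient exists. [folklore] -/
theorem exists_rayleigh_min (M : Matrix (Fin 3) (Fin 3) ℝ) :
    ∃ g₀ ∈ unitSet, ∀ z ∈ unitSet, g₀ ⬝ᵥ (M *ᵥ g₀) ≤ z ⬝ᵥ (M *ᵥ z) := by
  have hc : Continuous fun g : Fin 3 → ℝ ↦ g ⬝ᵥ (M *ᵥ g) :=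
    continuous_id.dotProduct (continuous_const.matrix_mulVec continuous_id)
  obtain ⟨g₀, hg₀, hmin⟩ := isCompact_unitSet.exists_isMinOn unitSet_nonempty hc.continuousOn
  refine ⟨g₀, hg₀, fun z hz ↦ ?_⟩
  have h := hmin hz
  simp only [mem_setOf_eq] at h
  exact h

/-- **The minimising plane contains a global Rayleigh minimiser** (exchange argument): if the
orthonormal pair `(w, w')` with unit normal `n` minimises the pair sum, and `e` minimises the
Rayleigh quotient among unit vectors `⊥ n` (i.e. `eᵀAe ≤ gᵀAg` for all unit `g ⊥ n`), then
`eᵀAe ≤ gᵀAg` for every unit `g`. [folklore] -/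
theorem rayleigh_planeMin_le {w w' n e : Fin 3 → ℝ} (hw : w ⬝ᵥ w = 1)
    (hw' : w' ⬝ᵥ w' = 1) (hn : n ⬝ᵥ n = 1) (hww' : w ⬝ᵥ w' = 0) (hwn : w ⬝ᵥ n = 0)
    (hw'n : w' ⬝ᵥ n = 0) (hmin : ∀ r ∈ pairSet, pairSumQ A (w, w') ≤ pairSumQ A r)
    (hemin : ∀ g : Fin 3 → ℝ, g ⬝ᵥ g = 1 → g ⬝ᵥ n = 0 → e ⬝ᵥ (A *ᵥ e) ≤ g ⬝ᵥ (A *ᵥ g))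
    {g : Fin 3 → ℝ} (hg : g ⬝ᵥ g = 1) : e ⬝ᵥ (A *ᵥ e) ≤ g ⬝ᵥ (A *ᵥ g) := by
  -- a unit `f ⊥ n, g`, and its in-plane partner `f' = n × f`
  obtain ⟨f, hf, hfn, hfg⟩ := exists_unit_perp_perp n g
  set f' := n ⨯₃ f with hf'
  have hnf : n ⬝ᵥ f = 0 := by rw [dotProduct_comm]; exact hfn
  have hf'1 : f' ⬝ᵥ f' = 1 := dotProduct_cross_self_of_orthonormal hn hf hnf
  have hnf' : n ⬝ᵥ f' = 0 := dot_self_cross n f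
  have hff' : f ⬝ᵥ f' = 0 := dot_cross_self n f
  -- traces: `fᵀAf + f'ᵀAf' = pair sum of (w, w')`
  have ht1 := sum_quadratic_eq_trace_of_orthonormal A hf hf'1 hn hff' hfn (by rw [dotProduct_comm]; exact hnf')
  have ht2 := sum_quadratic_eq_trace_of_orthonormal A hw hw' hn hww' hwn hw'n
  -- the pair `(g, f)` competes
  have hpair := hmin (g, f) ⟨hg, hf, by rw [dotProduct_comm]; exact hfg⟩
  -- `f'` competes in the plane
  have hf'min := hemin f' hf'1 (by rw [dotProduct_comm]; exact hnf')
  simp only [pairSumQ] at hpair ht2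
  linarith

/-- **The A-side package at a minimising pair of the pair sum.** For symmetric `A` and an
orthonormal pair `(w, w')` minimising `wᵀAw + w'ᵀAw'` over orthonormal pairs there are reals
`a₁ ≤ a₂ ≤ a₃` and a unit `n` with: the pair sum equals `a₁ + a₂`; `a₁ ≤ gᵀAg ≤ a₃` for every
unit `g`; `nᵀAn = a₃`; and for every `B`,
`wᵀA'w + w'ᵀA'w' = a₁² + a₂² + (tr(BᵀB) - |ᵗBn|²) + 2a₃(a₁ + a₂)`, `A' = A² + BᵗB + 2A^#`
(Hamilton: `d(a₁ + a₂)/dt ≥ a₁² + a₂² + b₁² + b₂² + 2a₃(a₁ + a₂)`, here in exact form).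
[cite: Hamilton1997, §2.2, Thm. 2.1 (proof, p. 15)] -/
theorem planeMin_package (hA : A.IsSymm) {w w' : Fin 3 → ℝ} (hw : w ⬝ᵥ w = 1) (hw' : w' ⬝ᵥ w' = 1)
    (hww' : w ⬝ᵥ w' = 0) (hmin : ∀ r ∈ pairSet, pairSumQ A (w, w') ≤ pairSumQ A r) :
    ∃ a₁ a₂ a₃ : ℝ, ∃ n : Fin 3 → ℝ, n ⬝ᵥ n = 1 ∧ pairSumQ A (w, w') = a₁ + a₂ ∧ a₁ ≤ a₂ ∧
      a₂ ≤ a₃ ∧ (∀ g : Fin 3 → ℝ, g ⬝ᵥ g = 1 → a₁ ≤ g ⬝ᵥ (A *ᵥ g) ∧ g ⬝ᵥ (A *ᵥ g) ≤ a₃) ∧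
      n ⬝ᵥ (A *ᵥ n) = a₃ ∧
      pairSumQ (A * A + B * Bᵀ + (2 : ℝ) • A.sharp) (w, w') =
        a₁ ^ 2 + a₂ ^ 2 + ((B * Bᵀ).trace - (Bᵀ *ᵥ n) ⬝ᵥ (Bᵀ *ᵥ n)) + 2 * a₃ * (a₁ + a₂) := by
  -- the normal `n` and its extremality
  set n := w ⨯₃ w' with hn
  have hn1 : n ⬝ᵥ n = 1 := dotProduct_cross_self_of_orthonormal hw hw' hww'
  have hwn : w ⬝ᵥ n = 0 := dot_self_cross w w'
  have hw'n : w' ⬝ᵥ n = 0 := dot_cross_self w w'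
  have hmin' : ∀ y y' : Fin 3 → ℝ, y ⬝ᵥ y = 1 → y' ⬝ᵥ y' = 1 → y ⬝ᵥ y' = 0 →
      w ⬝ᵥ (A *ᵥ w) + w' ⬝ᵥ (A *ᵥ w') ≤ y ⬝ᵥ (A *ᵥ y) + y' ⬝ᵥ (A *ᵥ y') :=
    fun y y' a b c ↦ hmin (y, y') ⟨a, b, c⟩
  have hMA : ∀ g : Fin 3 → ℝ, g ⬝ᵥ g = 1 → g ⬝ᵥ (A *ᵥ g) ≤ n ⬝ᵥ (A *ᵥ n) :=
    fun g hg ↦ rayleigh_le_normal_of_min hw hw' hn1 hww' hwn hw'n hmin' hg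
  have hn0 : ∀ z : Fin 3 → ℝ, z ⬝ᵥ n = 0 → n ⬝ᵥ (A *ᵥ z) = 0 :=
    fun z hz ↦ cross_eq_zero_of_max hA hn1 (fun z hz ↦ hMA z hz) hz
  -- the in-plane minimiser `e`, a global minimiser, hence an eigenvector
  obtain ⟨e, he, hen, hemin⟩ := exists_min_rayleigh_perp A hw hwn
  have heglob : ∀ g : Fin 3 → ℝ, g ⬝ᵥ g = 1 → e ⬝ᵥ (A *ᵥ e) ≤ g ⬝ᵥ (A *ᵥ g) :=
    fun g hg ↦ rayleigh_planeMin_le hw hw' hn1 hww' hwn hw'n hmin hemin hg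
  have he0 : ∀ z : Fin 3 → ℝ, z ⬝ᵥ e = 0 → e ⬝ᵥ (A *ᵥ z) = 0 :=
    fun z hz ↦ cross_eq_zero_of_min hA he (fun z hz ↦ heglob z hz) hz
  -- the in-plane partner `e' = n × e`
  set e' := n ⨯₃ e with he'
  have hne : n ⬝ᵥ e = 0 := by rw [dotProduct_comm]; exact hen
  have he'1 : e' ⬝ᵥ e' = 1 := dotProduct_cross_self_of_orthonormal hn1 he hne
  have hne' : n ⬝ᵥ e' = 0 := dot_self_cross n e
  have hee' : e ⬝ᵥ e' = 0 := dot_cross_self n e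
  have he'n : e' ⬝ᵥ n = 0 := by rw [dotProduct_comm]; exact hne'
  -- cross terms vanish
  have cee' : e ⬝ᵥ (A *ᵥ e') = 0 := he0 e' (by rw [dotProduct_comm]; exact hee')
  have cen : e ⬝ᵥ (A *ᵥ n) = 0 := by rw [quad_comm_of_isSymm hA]; exact hn0 e hen
  have ce'n : e' ⬝ᵥ (A *ᵥ n) = 0 := by rw [quad_comm_of_isSymm hA]; exact hn0 e' he'n
  -- traces
  have ht1 := sum_quadratic_eq_trace_of_orthonormal A he he'1 hn1 hee' hen he'n
  have ht2 := sum_quadratic_eq_trace_of_orthonormal A hw hw' hn1 hww' hwn hw'n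
  have ht1' := sum_quadratic_eq_trace_of_orthonormal (A * A + B * Bᵀ + (2 : ℝ) • A.sharp)
    he he'1 hn1 hee' hen he'n
  have ht2' := sum_quadratic_eq_trace_of_orthonormal (A * A + B * Bᵀ + (2 : ℝ) • A.sharp)
    hw hw' hn1 hww' hwn hw'n
  have htB := sum_normSq_transpose_eq_trace (B := B) he he'1 hn1 hee' hen he'n
  -- the exact identity in the eigenbasis
  have hfield := pairSum_field_eq (B := B) hA he he'1 hn1 hee' hen he'n cen ce'n
  have hsq := normSq_pair_eq hA he he'1 hn1 hee' hen he'n cen ce'n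
  rw [cee'] at hsq
  refine ⟨e ⬝ᵥ (A *ᵥ e), e' ⬝ᵥ (A *ᵥ e'), n ⬝ᵥ (A *ᵥ n), n, hn1, ?_, heglob e' he'1, hMA e' he'1,
    fun g hg ↦ ⟨heglob g hg, hMA g hg⟩, rfl, ?_⟩
  · simp only [pairSumQ]; linarith
  · simp only [pairSumQ] at ht2' ⊢
    nlinarith [hfield, hsq, htB, ht1', ht2', ht1, ht2]

/-! ### The maximising singular pair: `b₁`, `tr(B ᵗB)` and `det B` -/

/-- A minimiser of `|ᵗBg|²` over unit `g` exists. [folklore] -/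
theorem exists_min_normSq_transpose (B : Matrix (Fin 3) (Fin 3) ℝ) :
    ∃ g₀ ∈ unitSet, ∀ g ∈ unitSet, (Bᵀ *ᵥ g₀) ⬝ᵥ (Bᵀ *ᵥ g₀) ≤ (Bᵀ *ᵥ g) ⬝ᵥ (Bᵀ *ᵥ g) := by
  obtain ⟨g₀, hg₀, h⟩ := exists_rayleigh_min (B * Bᵀ)
  refine ⟨g₀, hg₀, fun g hg ↦ ?_⟩
  rw [← quad_mul_transpose_self, ← quad_mul_transpose_self]
  exact h g hg

/-- **`|det B| ≤ b₁ (b₂² + b₃²)/2`, variationally**: with `g₀` a unit minimiser of `|ᵗBg|²`,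
`β = |ᵗBg₀|` and `F = tr(BᵗB)`, `|det B| ≤ β (F - β²)/2` (triple product in an orthonormal
basis through `g₀`, Lagrange's identity, and `PQ ≤ ((P + Q)/2)²`). [folklore] -/
theorem abs_det_le_min_mul {g₀ : Fin 3 → ℝ} (hg₀ : g₀ ⬝ᵥ g₀ = 1) :
    |B.det| ≤ ((Bᵀ *ᵥ g₀) ⬝ᵥ (Bᵀ *ᵥ g₀)).sqrt *
      ((B * Bᵀ).trace - (Bᵀ *ᵥ g₀) ⬝ᵥ (Bᵀ *ᵥ g₀)) / 2 := by
  obtain ⟨g₁, g₂, h₁, h₂, h₀₁, h₀₂, h₁₂⟩ := exists_orthonormal_complement hg₀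
  set R : Matrix (Fin 3) (Fin 3) ℝ := Matrix.of ![g₀, g₁, g₂] with hR
  have hRRt : R * Rᵀ = 1 := frame3_mul_transpose hg₀ h₁ h₂ h₀₁ h₀₂ h₁₂
  have hdetR : R.det ^ 2 = 1 := by
    have := congrArg Matrix.det hRRt
    rwa [Matrix.det_mul, Matrix.det_transpose, Matrix.det_one, ← sq] at this
  have hRB : R * B = Matrix.of ![Bᵀ *ᵥ g₀, Bᵀ *ᵥ g₁, Bᵀ *ᵥ g₂] := by
    ext i j
    simp only [Matrix.mul_apply, Matrix.of_apply, Fin.sum_univ_three]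
    fin_cases i <;> simp [R, Matrix.mulVec, dotProduct, Fin.sum_univ_three, Matrix.transpose_apply] <;> ring
  have hdet : B.det ^ 2 = ((Bᵀ *ᵥ g₀) ⬝ᵥ ((Bᵀ *ᵥ g₁) ⨯₃ (Bᵀ *ᵥ g₂))) ^ 2 := by
    rw [triple_product_eq_det, show (![Bᵀ *ᵥ g₀, Bᵀ *ᵥ g₁, Bᵀ *ᵥ g₂] : Matrix (Fin 3) (Fin 3) ℝ) =
      R * B from hRB.symm, Matrix.det_mul, mul_pow, hdetR, one_mul]
  -- the trace splits over the basis
  have htr := sum_normSq_transpose_eq_trace (B := B) hg₀ h₁ h₂ h₀₁ h₀₂ h₁₂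
  set P := (Bᵀ *ᵥ g₁) ⬝ᵥ (Bᵀ *ᵥ g₁) with hP
  set Q := (Bᵀ *ᵥ g₂) ⬝ᵥ (Bᵀ *ᵥ g₂) with hQ
  set b := (Bᵀ *ᵥ g₀) ⬝ᵥ (Bᵀ *ᵥ g₀) with hb
  have hP0 : 0 ≤ P := Finset.sum_nonneg fun i _ ↦ mul_self_nonneg _
  have hQ0 : 0 ≤ Q := Finset.sum_nonneg fun i _ ↦ mul_self_nonneg _
  have hb0 : 0 ≤ b := Finset.sum_nonneg fun i _ ↦ mul_self_nonneg _
  have hFb : (B * Bᵀ).trace - b = P + Q := by linarith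
  have h1 := dot_sq_le (Bᵀ *ᵥ g₀) ((Bᵀ *ᵥ g₁) ⨯₃ (Bᵀ *ᵥ g₂))
  have h2 : ((Bᵀ *ᵥ g₁) ⨯₃ (Bᵀ *ᵥ g₂)) ⬝ᵥ ((Bᵀ *ᵥ g₁) ⨯₃ (Bᵀ *ᵥ g₂)) ≤ P * Q := by
    rw [cross_dot_cross, dotProduct_comm (Bᵀ *ᵥ g₂) (Bᵀ *ᵥ g₁)]
    nlinarith [sq_nonneg ((Bᵀ *ᵥ g₁) ⬝ᵥ (Bᵀ *ᵥ g₂))]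
  have hsq : B.det ^ 2 ≤ b * ((P + Q) / 2) ^ 2 := by
    rw [hdet]
    calc ((Bᵀ *ᵥ g₀) ⬝ᵥ ((Bᵀ *ᵥ g₁) ⨯₃ (Bᵀ *ᵥ g₂))) ^ 2 ≤ b * (P * Q) :=
          h1.trans (mul_le_mul_of_nonneg_left h2 hb0)
      _ ≤ b * ((P + Q) / 2) ^ 2 := mul_le_mul_of_nonneg_left (by nlinarith [sq_nonneg (P - Q)]) hb0
  have := Real.sqrt_le_sqrt hsq
  rw [Real.sqrt_sq_eq_abs, Real.sqrt_mul hb0, Real.sqrt_sq (by positivity)] at this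
  rw [hFb, mul_div_assoc]
  exact this

/-- **The B-side package at a maximising pair of `uᵀBv`.** At a maximising pair `(u, v)` of
`uᵀBv` over unit vectors with value `Y > 0`: `uᵀ(AB + BC + 2B^#)v = Y(uᵀAu + vᵀCv) + 2det B/Y`,
and there is `β ≥ 0` (`= b₁ = min |ᵗBg|`) with `Y² + 2β² ≤ tr(BᵀB) ≤ 2Y² + β²` and
`|det B| ≤ β(tr(BᵀB) - β²)/2` (Hamilton 1986, Lemma 6.1: `d b₃/dt ≤ a₃b₃ + b₃c₃ + 2b₁b₂`).
[cite: Hamilton1997, §2.2, Thm. 2.1 (proof, p. 15)] -/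
theorem singularMax_package {u v : Fin 3 → ℝ} (hu : u ⬝ᵥ u = 1) (hv : v ⬝ᵥ v = 1)
    (hmax : ∀ u' v' : Fin 3 → ℝ, u' ⬝ᵥ u' = 1 → v' ⬝ᵥ v' = 1 → u' ⬝ᵥ (B *ᵥ v') ≤ u ⬝ᵥ (B *ᵥ v))
    (hY : 0 < u ⬝ᵥ (B *ᵥ v)) :
    u ⬝ᵥ ((A * B + B * C + (2 : ℝ) • B.sharp) *ᵥ v) =
        (u ⬝ᵥ (B *ᵥ v)) * (u ⬝ᵥ (A *ᵥ u) + v ⬝ᵥ (C *ᵥ v)) + 2 * B.det / (u ⬝ᵥ (B *ᵥ v)) ∧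
      ∃ β : ℝ, 0 ≤ β ∧ (u ⬝ᵥ (B *ᵥ v)) ^ 2 + 2 * β ^ 2 ≤ (B * Bᵀ).trace ∧
        (B * Bᵀ).trace ≤ 2 * (u ⬝ᵥ (B *ᵥ v)) ^ 2 + β ^ 2 ∧
        |B.det| ≤ β * ((B * Bᵀ).trace - β ^ 2) / 2 := by
  set Y := u ⬝ᵥ (B *ᵥ v) with hYdef
  obtain ⟨hBv, hBu⟩ := bilinear_firstOrder hu hv hmax
  constructor
  · rw [bilinear_field_eq (A := A) (C := C) hBv hBu]
    have hdet := adj_term_eq (B := B) hu hBu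
    rw [← hdet]
    field_simp
    ring
  -- `β = |ᵗBg₀|` at a minimiser `g₀`
  obtain ⟨g₀, hg₀, hg₀min⟩ := exists_min_normSq_transpose B
  set b := (Bᵀ *ᵥ g₀) ⬝ᵥ (Bᵀ *ᵥ g₀) with hb
  have hb0 : 0 ≤ b := Finset.sum_nonneg fun i _ ↦ mul_self_nonneg _
  have hβ2 : b.sqrt ^ 2 = b := Real.sq_sqrt hb0
  have hbnd : ∀ e : Fin 3 → ℝ, e ⬝ᵥ e = 1 → (Bᵀ *ᵥ e) ⬝ᵥ (Bᵀ *ᵥ e) ≤ Y ^ 2 := fun e he ↦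
    normSq_mulTranspose_le_sq_of_bound hY.le fun v' hv' ↦ hmax e v' he hv'
  refine ⟨b.sqrt, Real.sqrt_nonneg _, ?_, ?_, ?_⟩
  · -- basis `(u, u₁, u₂)`: `|ᵗBu|² = Y²`, the others `≥ β²`
    obtain ⟨u₁, u₂, h₁, h₂, h₀₁, h₀₂, h₁₂⟩ := exists_orthonormal_complement hu
    have htr := sum_normSq_transpose_eq_trace (B := B) hu h₁ h₂ h₀₁ h₀₂ h₁₂
    have hYu : (Bᵀ *ᵥ u) ⬝ᵥ (Bᵀ *ᵥ u) = Y ^ 2 := by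
      rw [hBu, smul_dotProduct, dotProduct_smul, hv, smul_eq_mul, smul_eq_mul]; ring
    have h1 := hg₀min u₁ h₁
    have h2 := hg₀min u₂ h₂
    rw [hβ2]; linarith
  · -- basis `(g₀, g₁, g₂)`: `β² + ≤ Y² + ≤ Y²`
    obtain ⟨g₁, g₂, h₁, h₂, h₀₁, h₀₂, h₁₂⟩ := exists_orthonormal_complement hg₀
    have htr := sum_normSq_transpose_eq_trace (B := B) hg₀ h₁ h₂ h₀₁ h₀₂ h₁₂
    have h1 := hbnd g₁ h₁
    have h2 := hbnd g₂ h₂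
    rw [hβ2]; linarith
  · rw [hβ2]; exact abs_det_le_min_mul hg₀

end HamiltonODE

end Literature.Geometry.Riemannian

end
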